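import Summits.KontsevichZagierPeriods.Zeta5Search.TwoTaleSecondTaleLineDecay
import Summits.KontsevichZagierPeriods.Zeta5Search.TwoTaleP15SecondLineCertificate
import Summits.KontsevichZagierPeriods.Zeta5Search.Denom.TwoTaleP15TopWindow

/-!
# Second tale at the P15 partner: `DecayT 29.1` PROVED (design value `29.10787`)

HONEST FRAMING: systematic search; no irrationality claim unless certified.  Cell pub-zeta5, class `measure`
(fam-measure g5 with P1 g10, RULINGS R3′/R6), T3/T4.  This file makes NO statement about the irrationality measure of
`ζ(2)`: it proves the DECAY of Zudilin's second-tale linear forms at the Remark-5 partner of the cell's P15 point,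
`|q̂ₙ ζ(2) − p̂ₙ| ≤ e^{−c·n}` eventually for every `c < 29.10786` (`Denom.TwoTaleP15Coincidence.DecayT c`, until
now a `@[conjecture]` design value), and records which CONDITIONAL tree theorems thereby lose their decay
hypothesis.  The hypothesis-free consequence through P1 g10's W1 route
(`TwoTaleP15CoincidenceW1.zetaTwo_exponent_le_of_decayT_W1`, input `DecayT c′`, `c′ ≥ 25.5`) is deliberately NOT
drawn here: by RULING R6 (e) it goes to the referee first.

The chain (all PROVED, no named input left):
* U2-1/U2-2 `TwoTaleSechKernel`, `TwoTaleSechMoments` — the first-power kernel `sech1 y = π/cosh(πy)`, its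
  strip/residue steps and polar-part moments (`polarLine2 0 ½ = π ζ(2)`);
* U2-3 `TwoTaleSecondTaleLineRep` — `|q̂ ζ(2) − p̂| = ‖lineT (â,b̂) ½‖/(4π)` for admissible second-tale data
  ([Zudilin2014ZetaTwo] (25), Lemma 3, Prop. 3's analytic half);
* U2-4 `TwoTaleSecondTaleStripShift` — shift to the saddle line `Re u = mₙ + ½` across the integer zeros of `R̂ₙ`;
* U2-5 `TwoTaleSecondTaleLineRate` — the scaled line bound `log ‖R̂ₙ‖ ≤ n·rateT η + 8 log(19² + (2η)²) + constLineT`;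
* U2-6 `TwoTaleSecondTaleLineDecay` — the `dy`-assembly `decayT_of_certT`, bridge `rateT = profileT0 (−897/100)`;
* P1 g10 `TwoTaleP15SecondLineProfileShape` + `TwoTaleP15SecondLineCertificate` — the one-variable side: profile
  shape and the `decide +kernel` two-point tangent certificate `certT_delta` (design sup `−29.1078672`, `η ≈ 1.2915`).
Results:
* `decayT_of_lt : c < 29.10786 → DecayT c`; **`decayT_holds : DecayT 29.1`**, `decayT_holds_sharp : DecayT 29.1078`,
  `decayT_holds_29 : DecayT 29` (R3′ design target), `decayT_holds_floor : DecayT 28.462` (the input of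
  fam-denom's files 44–46), `decayT_holds_W1 : DecayT 25.5` (the threshold of P1's W1 route);
* `zetaTwo_exponent_le_of_prop3T_topWindowT`, `zetaTwo_exponent_le_of_integralTFlat` — fam-denom's conditional
  endgames `Denom.TwoTaleP15TopWindow.zetaTwo_exponent_le_of_topWindowT` / `…CoincidenceFlat…_flat_num` with the
  decay input discharged; they remain CONDITIONAL on `Prop3T ∧ TopWindowT`, resp. `IntegralTFlat` (named, unproved
  here), so NOTHING about `μ(ζ(2))` is asserted by this file.
References: W. Zudilin, arXiv:1310.1526 [Zudilin2014ZetaTwo] §6, (25), Prop. 3, Remark 5.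
-/

noncomputable section

open Real
open Literature.NumberTheory.Irrationality.Zudilin2014
open Literature.NumberTheory.Transcendental (zetaValue)
open Summit.KontsevichZagierPeriods.Zeta5Search.Denom.TwoTaleP15Coincidence (DecayT)
open Summit.KontsevichZagierPeriods.Zeta5Search.Denom.TwoTaleP15CoincidenceFlat (IntegralTFlat
  zetaTwo_exponent_le_of_decayT_flat_num)
open Summit.KontsevichZagierPeriods.Zeta5Search.Denom.TwoTaleP15TopWindow (Prop3T TopWindowT
  zetaTwo_exponent_le_of_topWindowT)
open Summit.KontsevichZagierPeriods.Zeta5Search.TwoTaleP15SecondLineCertificate (certT_delta)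
open Summit.KontsevichZagierPeriods.Zeta5Search.TwoTaleSecondTaleLineDecay (decayT_of_certT)

namespace Summit.KontsevichZagierPeriods.Zeta5Search.TwoTaleSecondTaleDecayHolds

/-- **`DecayT c` for every `c < 29.10786`**: P1 g10's kernel interval certificate `certT_delta` fed into
fam-measure's `dy`-assembly `decayT_of_certT`. -/
theorem decayT_of_lt {c : ℝ} (hc : c < 29.10786) : DecayT c :=
  decayT_of_certT (fun _ h0 h3 η hη => certT_delta h0 h3 η hη) hc

/-- **`DecayT 29.1` PROVED** (the cell's tale-2 design value is `29.10787`). -/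
theorem decayT_holds : DecayT 29.1 := decayT_of_lt (by norm_num)

/-- `DecayT 29.1078` (four digits of the design value `29.1078713`; the certified line `ξ = −897/100` gives
`29.1078672`). -/
theorem decayT_holds_sharp : DecayT 29.1078 := decayT_of_lt (by norm_num)

/-- `DecayT 29` — the design target named in RULING R3′. -/
theorem decayT_holds_29 : DecayT 29 := decayT_of_lt (by norm_num)

/-- `DecayT 28.462` — the decay input of fam-denom's `Denom.TwoTaleP15TopWindow.zetaTwo_exponent_le_of_topWindowT`
and `Denom.TwoTaleP15CoincidenceFlat.zetaTwo_exponent_le_of_decayT_flat_num` (`28.462 = 31 − ivlRate 9`, rounded). -/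
theorem decayT_holds_floor : DecayT 28.462 := decayT_of_lt (by norm_num)

/-- `DecayT 25.5` — the threshold of P1 g10's W1 route `TwoTaleP15CoincidenceW1.zetaTwo_exponent_le_of_decayT_W1`
(whose hypothesis-free instantiation is reported to the referee first, RULING R6 (e); it is not drawn in this file). -/
theorem decayT_holds_W1 : DecayT 25.5 := decayT_of_lt (by norm_num)

/-- fam-denom's window endgame with the decay input discharged: **still CONDITIONAL** on `Prop3T` ([Zu14, Prop. 3]
`p̂`-half, being formalised by fam-denom g8) and `TopWindowT` (THEOREM W, staged by fam-denom g8). -/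
theorem zetaTwo_exponent_le_of_prop3T_topWindowT (h3 : Prop3T) (hW : TopWindowT) :
    ExponentLE (zetaValue 2) 5.0499 ∧ zetaTwo_irrationalityExponent_le :=
  zetaTwo_exponent_le_of_topWindowT decayT_holds_floor h3 hW

/-- fam-denom's flat endgame with the decay input discharged: **still CONDITIONAL** on `IntegralTFlat`. -/
theorem zetaTwo_exponent_le_of_integralTFlat (hT : IntegralTFlat) :
    ExponentLE (zetaValue 2) 5.0499 ∧ zetaTwo_irrationalityExponent_le :=
  zetaTwo_exponent_le_of_decayT_flat_num decayT_holds_floor hT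

end Summit.KontsevichZagierPeriods.Zeta5Search.TwoTaleSecondTaleDecayHolds

end
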